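import Literature.Barriers.ValiantsHypothesis.GCTMatrixPoweringColumns
import Literature.NumberTheory.DiophantineGeometry.KroneckerPointSets
import Literature.Computability.Complexity.OccurrenceObstructionsIP
import HarnessLib

/-!
# Gesmundo–Ikenmeyer–Panova 2017, Prop. 20 PROVED from its printed ingredients (Props. 15, 17, 18,
# 19); Thm. 10 (`GIP2017_thm10`, barrier `GCTMatrixPowering`) from those four named facts

Sibling proofs file (D-0014; theorems only) of `GCTMatrixPoweringColumns.lean` and
`GCTMatrixPoweringProofs.lean` (conventions as there). `GCTMatrixPoweringProofs.lean` reduced GIP's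
Main Result Thm. 10 to the positivity statement Prop. 20 (`GIP2017_thm10_of_prop20`; Lemma 12 and
Prop. 13 proved there); `GCTMatrixPoweringColumns.lean` vendored the four results of §3 that the printed
proof of Prop. 20 (arXiv:1611.00827, pp. 11–12) invokes — Prop. 15 (semigroup property, positivity
form), Prop. 17 (columns `1^a`), Prop. 18 (shapes with at most `14` rows, computer-checked in print),
Prop. 19 (`(2,2,1^a)`) — together with the column calculus (`colCount`, `ofColumns`, `IsRowSum`,
`Nat.Partition.column`, `twoTwoCol`). Here Prop. 20 is PROVED from them (`GIP2017_prop20_of_parts`), following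
the printed case analysis on the number `x` of exceptional columns of `λ` (column lengths in
`X_s = {2,3,4,7,8,12}`):

* `x = 0` or `x ≥ 2`: the exceptional columns form a shape `β` with at most `12` rows which is not
  one of the nine exceptions (two or more columns, all of length `≥ 2`: `parts_ofColumns_not_mem`),
  so `sm(β, 7) > 0` (Prop. 18); the other columns `α` have `sm(α, ℓ) > 0` by Prop. 17 and
  Prop. 15(1) (`smPos_ofColumns`); `λ = α + β` row-wise (`isRowSum_ofColumns`) and Prop. 15(1).
* `x = 1`, exceptional column `r ≠ 2` (so `r ∉ X_a`), `k` the LONGEST other column: `k ∉ X_a` —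
  `am(1^k), am(1^r) > 0` (Prop. 17) give `sm(1^k + 1^r) > 0` (Prop. 15(2)); `k ∈ X_a`, `k ≥ 2` —
  `1^k + 1^r` has two columns `≥ 2` and `≤ 14` rows, Prop. 18; `k = 1` — all other columns are
  singletons, `λ` has `r ≤ 12` rows and is not exceptional by hypothesis, Prop. 18 on `λ`.
* `x = 1`, `r = 2`: `k = 1` — as before; `λ = (2,2,1^{k-2})` (no third column) is excluded;
  `2 ≤ k ≤ 14` — Prop. 18 on `1^k + 1^2`; `k > 14` — Prop. 19 on `(2,2,1^{k-2})`: either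
  `sm > 0`, or `am > 0` and then the second longest other column `k₂` gives `sm(1^k+1^2+1^{k₂}) > 0`
  by Prop. 15(2) with `am(1^{k₂}) > 0` (Prop. 17, `k₂ > 14`), or, if `k₂ ≤ 14`, Prop. 18 on
  `1^{k₂} + 1^2` (for `k₂ = 1` this is `(2,1)`: two parts, largest part `2`, not exceptional).

The choice of the longest other column and the direct treatment of the hooks `1^r + 1 + ⋯ + 1`
and of `(2,1)` fill two points the printed text leaves implicit (its sentence "If `k ∈ X_a`, then
`k ≤ 14` and so `sm(1^k + 1^r, ℓ) > 0` by Proposition 18" does not cover `1^3 + 1^1 = (2,1,1)` and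
`1^8 + 1^1 = (2,1^7)`, which are exceptions of Prop. 18; and "Since `λ ≠ (2,2,1,1,…)`, there must be
at least 2 other columns" overlooks `λ = (2,1)`); the statement of Prop. 20 is unaffected.

Consequently (`GIP2017_thm10_of_parts`, `gctMatrixPowering_of_parts`) the barrier fact
`GCTMatrixPowering = GIP2017_thm10` rests on exactly the four named facts `GIP2017_prop15`,
`GIP2017_prop17`, `GIP2017_prop18`, `GIP2017_prop19` of GIP §3.

**Verdict clean-up (2026-08-15).** Two of those four statements are FALSE AS PRINTED and are now
refuted in the tree and `@[deprecated]` in `GCTMatrixPoweringColumns.lean`: `GIP2017_prop18` (the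
printed exceptional list omits `(2,1³)`; `not_GIP2017_prop18`, `GCTMatrixPoweringErratumProofs.lean`)
and `GIP2017_prop19` (the printed row bound fails at `a = s² - 2`, `s ≥ 7`; `GIP2017_prop19_false`,
`GCTMatrixPoweringProp19False.lean`). The three assembly theorems of §4 below take both as
hypotheses and are therefore vacuous; they are kept, `@[deprecated]` themselves (with
`linter.deprecated` off for exactly these declarations, which must name the deprecated records), as
the machine-checked record of the printed case analysis, which is re-run verbatim with the corrected
Prop. 18 in `GIP2017_prop20_corrected_of_parts` (`GCTMatrixPoweringErratum.lean`; still with the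
printed Prop. 19, hence deprecated as well) and with the corrected Props. 18 and 19 in
`GIP2017_prop20_corrected_of_prop18` (`GCTMatrixPoweringProp17.lean`). The live, unconditional chain
is `GIP2017_prop15_holds`, `GIP2017_prop17_if`, `GIP2017_prop18_corrected_holds`,
`GIP2017_prop19_corrected_holds`, `GIP2017_prop20_corrected_holds`, `GCTMatrixPowering_holds`
(`GCTMatrixPoweringProp20Holds.lean`); §§0–3 of this file are unaffected and in use.

## References

* [GesmundoIkenmeyerPanova2017] F. Gesmundo, C. Ikenmeyer, G. Panova, *Geometric complexity theory
  and matrix powering*, Diff. Geom. Appl. 55 (2017) 106–127 = arXiv:1611.00827, §3: Props. 15,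
  17, 18, 19, 20 and the proof of Prop. 20 (pp. 11–12 of the held text, flat numbering).
-/

noncomputable section

open scoped BigOperators

namespace Literature.Barriers.ValiantsHypothesis

open Literature.NumberTheory.DiophantineGeometry Literature.Computability.Complexity Finset

/-! ### 0. Bridges -/

/-- **`IsRowSum` is the graph of `Nat.Partition.rowAdd`**: the tree's row-wise sum `μ.rowAdd ν`
(`OccurrenceObstructionsIP.lean`, used in the accepted `ikenmeyerPanova2017_semigroup`) satisfies
`IsRowSum (μ.rowAdd ν) μ ν` (this is `getD_sortedParts_rowAdd`); conversely any `λ` with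
`IsRowSum λ μ ν` has the parts of `μ.rowAdd ν` (rows determine the parts,
`parts_eq_of_getD_sortedParts_eq` of `KroneckerPointSets.lean`). [folklore] -/
theorem isRowSum_rowAdd {a b : ℕ} (mu : Nat.Partition a) (nu : Nat.Partition b) :
    IsRowSum (mu.rowAdd nu) mu nu :=
  getD_sortedParts_rowAdd mu nu

/-- The parts of a row-wise sum are those of `Nat.Partition.rowAdd`. [folklore] -/
theorem IsRowSum.parts_eq_rowAdd {c a b : ℕ} {lam : Nat.Partition c} {mu : Nat.Partition a}
    {nu : Nat.Partition b} (h : IsRowSum lam mu nu) : lam.parts = (mu.rowAdd nu).parts :=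
  parts_eq_of_getD_sortedParts_eq fun i => by rw [h i, getD_sortedParts_rowAdd]

/-- `ℓ(L) = max{⌈√L⌉ + 2, 12}` is a positive number of rows. [cite: GesmundoIkenmeyerPanova2017, Prop. 20] -/
theorem gipEll_pos (L : ℕ) : 0 < gipEll L :=
  lt_of_lt_of_le (by norm_num) (twelve_le_gipEll L)

/-! ### 1. The row bound `ℓ = max{⌈√L⌉ + 2, 12}` dominates the bounds of Props. 17–19 -/

/-- For a column of length `c ≤ L`, Prop. 17's bound `max{⌊√c⌋ + 2, 12}` is at most Prop. 20's
`ℓ = max{⌈√L⌉ + 2, 12}`. [cite: GesmundoIkenmeyerPanova2017, §3 (proof of Prop. 20)] -/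
theorem max_sqrt_add_two_le_gipEll {c L : ℕ} (h : c ≤ L) : max (Nat.sqrt c + 2) 12 ≤ gipEll L := by
  have h1 : Nat.sqrt c ≤ Nat.sqrt L := Nat.sqrt_le_sqrt h
  have h2 : Nat.sqrt L ≤ gipEll L - 2 := by
    have := Nat.sqrt_le_sqrt (le_gipEll_sub_two_sq L)
    rwa [Nat.sqrt_eq'] at this
  have h3 := twelve_le_gipEll L
  omega

/-- For `k ≤ L`, Prop. 19's bound `max{7, ⌈√k⌉}` (for `(2,2,1^{k-2})`, `a + 2 = k`) is at most
`ℓ`. [cite: GesmundoIkenmeyerPanova2017, §3 (proof of Prop. 20)] -/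
theorem max_seven_sqrt_le_gipEll {k L : ℕ} (hk : 2 ≤ k) (h : k ≤ L) :
    max 7 (Nat.sqrt (k - 2 + 1) + 1) ≤ gipEll L := by
  have h1 : Nat.sqrt (k - 2 + 1) ≤ Nat.sqrt L := Nat.sqrt_le_sqrt (by omega)
  have h2 : Nat.sqrt L ≤ gipEll L - 2 := by
    have := Nat.sqrt_le_sqrt (le_gipEll_sub_two_sq L)
    rwa [Nat.sqrt_eq'] at this
  have h3 := twelve_le_gipEll L
  omega

/-! ### 2. Columns and sums of good columns -/

/-- A nonexceptional column `1^c`, `c ∉ X_s`, `1 ≤ c ≤ L`, has `sm(1^c, ℓ) > 0` (Prop. 17 and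
monotonicity in the row bound). [cite: GesmundoIkenmeyerPanova2017, §3 (proof of Prop. 20: "each column 1^k in α, sm(1^k, ℓ) > 0")] -/
theorem smPos_column (h17 : GIP2017_prop17) {c L : ℕ} (hc1 : 1 ≤ c) (hcL : c ≤ L)
    (hcs : c ∉ gipXs) : SmPos (gipEll L) (Nat.Partition.column c) :=
  (((h17 c hc1).1).mpr hcs).mono (max_sqrt_add_two_le_gipEll hcL)

/-- A column `1^c`, `c ∉ X_a`, `1 ≤ c ≤ L`, has `am(1^c, ℓ) > 0` (Prop. 17).
[cite: GesmundoIkenmeyerPanova2017, §3 (proof of Prop. 20)] -/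
theorem amPos_column (h17 : GIP2017_prop17) {c L : ℕ} (hc1 : 1 ≤ c) (hcL : c ≤ L)
    (hca : c ∉ gipXa) : AmPos (gipEll L) (Nat.Partition.column c) :=
  (((h17 c hc1).2).mpr hca).mono (max_sqrt_add_two_le_gipEll hcL)

/-- **Adding up nonexceptional columns** (semigroup property, Prop. 15(1)): the shape whose columns
`S` all have lengths `c ∉ X_s` (`1 ≤ c ≤ L`) has `sm(·, ℓ) > 0` ("by the semigroup property adding
these columns we get `sm(α, ℓ) > 0`"). [cite: GesmundoIkenmeyerPanova2017, §3 (proof of Prop. 20)] -/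
theorem smPos_ofColumns (h15 : GIP2017_prop15) (h17 : GIP2017_prop17) {L : ℕ} :
    ∀ S : Multiset ℕ, (∀ c ∈ S, 1 ≤ c ∧ c ≤ L ∧ c ∉ gipXs) → SmPos (gipEll L) (ofColumns S) := by
  intro S
  induction S using Multiset.induction_on with
  | empty =>
    intro _
    exact smPos_of_eq_zero (by simp) _ _
  | cons c S ih =>
    intro hS
    obtain ⟨hc1, hcL, hcs⟩ := hS c (Multiset.mem_cons_self c S)
    have hrs : IsRowSum (ofColumns (c ::ₘ S)) (Nat.Partition.column c) (ofColumns S) :=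
      isRowSum_of_colCount (fun r => by rw [getD_sortedParts_ofColumns, Multiset.singleton_add])
        (getD_sortedParts_column c) (getD_sortedParts_ofColumns S)
    exact (h15 (gipEll L) (gipEll_pos L) _ _ _ hrs).1 (smPos_column h17 hc1 hcL hcs)
      (ih fun c' hc' => hS c' (Multiset.mem_cons_of_mem hc'))

/-! ### 3. Shapes that are not exceptional -/

/-- The nine exceptional shapes are single columns (largest part `1`) or have a column of length
one (their largest part occurs once): arithmetic on the nine members.
[cite: GesmundoIkenmeyerPanova2017, Prop. 20 (the exceptional list)] -/
theorem sup_eq_one_or_count_sup_eq_one_of_mem_gipExceptionalShapes {s : Multiset ℕ}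
    (h : s ∈ gipExceptionalShapes) : s.sup = 1 ∨ s.count s.sup = 1 := by
  rcases (mem_gipExceptionalShapes_iff s).mp h with
    rfl | rfl | rfl | rfl | rfl | rfl | rfl | rfl | rfl <;> decide

/-- The only exceptional shape with exactly two parts is `(1,1)`. [cite: GesmundoIkenmeyerPanova2017, Prop. 20 (the exceptional list)] -/
theorem sup_eq_one_of_mem_gipExceptionalShapes_of_card_eq_two {s : Multiset ℕ}
    (h : s ∈ gipExceptionalShapes) (h2 : s.card = 2) : s.sup = 1 := by
  rcases (mem_gipExceptionalShapes_iff s).mp h with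
    rfl | rfl | rfl | rfl | rfl | rfl | rfl | rfl | rfl <;>
    first | decide | (exfalso; revert h2; decide)

/-- If the first two rows of a partition both equal `v > 0`, the part `v` occurs at least twice.
[folklore] -/
theorem two_le_count_of_getD_eq {d : ℕ} (ν : Nat.Partition d) {v : ℕ} (hv : 0 < v)
    (h0 : ν.sortedParts.getD 0 0 = v) (h1 : ν.sortedParts.getD 1 0 = v) : 2 ≤ ν.parts.count v := by
  have hl : (ν.sortedParts : Multiset ℕ) = ν.parts := by simp [Nat.Partition.sortedParts]
  rw [← hl, Multiset.coe_count]
  rcases hν : ν.sortedParts with _ | ⟨a, _ | ⟨b, t⟩⟩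
  · rw [hν, List.getD_nil] at h1
    omega
  · rw [hν, List.getD_cons_succ, List.getD_nil] at h1
    omega
  · rw [hν, List.getD_cons_zero] at h0
    rw [hν, List.getD_cons_succ, List.getD_cons_zero] at h1
    subst h0
    subst h1
    simp only [List.count_cons, beq_self_eq_true, if_true]
    omega

/-- **Two or more columns, all of length `≥ 2`, never form an exceptional shape**: such a shape has
largest part `#columns ≥ 2` occurring at least twice (rows `0` and `1` are full).
[cite: GesmundoIkenmeyerPanova2017, §3 (proof of Prop. 20)] -/
theorem parts_ofColumns_not_mem {S : Multiset ℕ} (h2 : ∀ c ∈ S, 2 ≤ c) (hS : 2 ≤ S.card) :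
    (ofColumns S).parts ∉ gipExceptionalShapes := by
  intro hmem
  have h0 : (ofColumns S).sortedParts.getD 0 0 = S.card := by
    rw [getD_sortedParts_ofColumns, colCount_eq_card_of_forall_lt fun c hc => by
      have := h2 c hc; omega]
  have h1 : (ofColumns S).sortedParts.getD 1 0 = S.card := by
    rw [getD_sortedParts_ofColumns, colCount_eq_card_of_forall_lt fun c hc => h2 c hc]
  have hsup : (ofColumns S).parts.sup = S.card := by
    rw [sup_parts_eq_getD_sortedParts, h0]
  have hcount := two_le_count_of_getD_eq (ofColumns S) (by omega) h0 h1
  rcases sup_eq_one_or_count_sup_eq_one_of_mem_gipExceptionalShapes hmem with h | h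
  · rw [hsup] at h
    omega
  · rw [hsup] at h
    omega

/-! ### 4. Prop. 20 from Props. 15, 17, 18, 19 (as printed: vacuous since the verdict clean-up of 2026-08-15, deprecated) -/

-- `linter.deprecated` is switched off for the next declaration only: its hypotheses are the records
-- `GIP2017_prop18`, `GIP2017_prop19` of `GCTMatrixPoweringColumns.lean`, refuted as printed and
-- deprecated there (verdict clean-up 2026-08-15); this theorem must name them and is deprecated
-- itself. REMOVE-WHEN the two records are deleted from `GCTMatrixPoweringColumns.lean`.
set_option linter.deprecated false in
/-- **GIP Prop. 20 from its printed ingredients** (§3, pp. 11–12): Prop. 15 (semigroup, positivity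
form), Prop. 17 (columns), Prop. 18 (small shapes) and Prop. 19. The proof follows the printed case
analysis on the number `x` of exceptional columns (lengths in `X_s`) of `λ`: `x = 0` or `x ≥ 2` —
Prop. 18 on the exceptional columns `β`, Prop. 17 + Prop. 15(1) on the rest `α`; `x = 1` with the
exceptional column `r ≠ 2` — pair `r` with another column `k` through Prop. 15(2) (`k ∉ X_a`) or
Prop. 18 (`k ∈ X_a`); `r = 2` — Prop. 18 on `1^k + 1^2` for a column `k ≤ 14`, else Prop. 19 on
`(2,2,1^{k-2})` and, in its `am` branch, a second column `k₂ > 14` with Prop. 15(2). Two points left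
implicit in print are made explicit: the other column is chosen of MAXIMAL length (so that the pairs
`1^3 + 1^1 = (2,1,1)` and `1^8 + 1^1 = (2,1^7)`, which are exceptions of Prop. 18, only arise when all
other columns are singletons, in which case `λ` itself has at most `14` rows and Prop. 18 applies to
`λ`), and the two-column shape `(2,1)` (one column `2`, one column `1`) is settled by Prop. 18
directly.
**Deprecated (2026-08-15)** together with its hypotheses `GIP2017_prop18`, `GIP2017_prop19`, both
refuted as printed (`not_GIP2017_prop18`, `GIP2017_prop19_false`), which make this theorem vacuous;
*content unchanged*. Use `GIP2017_prop20_corrected_of_prop18` (`GCTMatrixPoweringProp17.lean`) or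
`GIP2017_prop20_corrected_holds` (`GCTMatrixPoweringProp20Holds.lean`), which run this very case
analysis on the corrected Props. 18 and 19. [cite: GesmundoIkenmeyerPanova2017, Prop. 20 (proof, §3 pp. 11–12)] -/
@[deprecated "vacuous: the hypotheses GIP2017_prop18 and GIP2017_prop19 are refuted as printed; use Literature.Barriers.ValiantsHypothesis.GIP2017_prop20_corrected_of_prop18 (GCTMatrixPoweringProp17.lean) or GIP2017_prop20_corrected_holds (GCTMatrixPoweringProp20Holds.lean)" (since := "2026-08-15")]
theorem GIP2017_prop20_of_parts (h15 : GIP2017_prop15) (h17 : GIP2017_prop17)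
    (h18 : GIP2017_prop18) (h19 : GIP2017_prop19) : GIP2017_prop20 := by
  intro D L lam hL hE h22
  -- the columns `C` of `λ`, the exceptional ones `X` and the others `A`
  set C := lam.transpose.parts with hC
  have hCpos : ∀ c ∈ C, 1 ≤ c := fun c hc => transpose_parts_pos lam c hc
  have hCL : ∀ c ∈ C, c ≤ L := fun c hc => (le_card_parts_of_mem_transpose lam hc).trans hL
  have hlamC : ∀ r, lam.sortedParts.getD r 0 = colCount C r :=
    getD_sortedParts_eq_colCount_transpose lam
  have hcardlam : lam.parts.card = C.sup := card_parts_eq_sup_transpose lam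
  set X := C.filter (fun c => c ∈ gipXs) with hX
  set A := C.filter (fun c => c ∉ gipXs) with hA
  have hCXA : C = X + A := (Multiset.filter_add_not _ C).symm
  have hAgood : ∀ c ∈ A, 1 ≤ c ∧ c ≤ L ∧ c ∉ gipXs := fun c hc => by
    rw [hA, Multiset.mem_filter] at hc
    exact ⟨hCpos c hc.1, hCL c hc.1, hc.2⟩
  have hXs : ∀ c ∈ X, c ∈ gipXs := fun c hc => by
    rw [hX, Multiset.mem_filter] at hc
    exact hc.2
  have hXge : ∀ c ∈ X, 2 ≤ c ∧ c ≤ 12 := fun c hc => by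
    have h := hXs c hc
    simp only [gipXs, Finset.mem_insert, Finset.mem_singleton] at h
    omega
  -- the tools
  have h12 : 12 ≤ gipEll L := twelve_le_gipEll L
  have combine : ∀ {c a b : ℕ} {lam' : Nat.Partition c} {mu : Nat.Partition a}
      {nu : Nat.Partition b},
      IsRowSum lam' mu nu → SmPos (gipEll L) mu → SmPos (gipEll L) nu → SmPos (gipEll L) lam' :=
    fun hrs hmu hnu => (h15 (gipEll L) (gipEll_pos L) _ _ _ hrs).1 hmu hnu
  have good : ∀ S : Multiset ℕ, S ≤ A → SmPos (gipEll L) (ofColumns S) := fun S hS =>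
    smPos_ofColumns h15 h17 S fun c hc => hAgood c (Multiset.mem_of_le hS hc)
  have small : ∀ {c : ℕ} (nu : Nat.Partition c), nu.parts.card ≤ 14 →
      nu.parts ∉ gipExceptionalShapes → SmPos (gipEll L) nu :=
    fun nu h1 h2 => (h18 _ nu h1 h2).mono (by omega)
  -- case analysis on the number of exceptional columns
  rcases Nat.lt_or_ge X.card 2 with hx | hx
  · rcases Nat.lt_or_ge X.card 1 with hx0 | hx1
    · -- `x = 0`: all columns are good
      have hX0 : X = 0 := Multiset.card_eq_zero.mp (by omega)
      have hrs : IsRowSum lam (ofColumns X) (ofColumns A) := isRowSum_ofColumns lam hCXA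
      refine combine hrs ?_ (good A le_rfl)
      exact smPos_of_eq_zero (by rw [hX0, Multiset.sum_zero]) _ _
    · -- `x = 1`: one exceptional column of length `r`
      obtain ⟨r, hXr⟩ := Multiset.card_eq_one.mp (by omega : X.card = 1)
      have hr : r ∈ gipXs := hXs r (by rw [hXr]; exact Multiset.mem_singleton_self r)
      have hr2 : 2 ≤ r ∧ r ≤ 12 := hXge r (by rw [hXr]; exact Multiset.mem_singleton_self r)
      -- there is another column; let `k` be the longest one
      have hA0 : A ≠ 0 := by
        intro hA0
        apply hE
        have hCr : C = {r} := by rw [hCXA, hXr, hA0, add_zero]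
        have hparts : lam.parts = (Nat.Partition.column r).parts :=
          parts_eq_of_getD_sortedParts_eq fun i => by rw [hlamC, hCr, getD_sortedParts_column]
        rw [hparts, Nat.Partition.column_parts]
        exact (replicate_mem_gipExceptionalShapes_iff r).mpr hr
      set k := A.sup with hk
      have hkA : k ∈ A := sup_mem_of_ne_zero hA0
      obtain ⟨hk1, hkL, hks⟩ := hAgood k hkA
      have hAle : ∀ c ∈ A, c ≤ k := fun c hc => Multiset.le_sup hc
      set A' := A.erase k with hA'
      have hAk : A = k ::ₘ A' := (Multiset.cons_erase hkA).symm
      have hA'le : A' ≤ A := Multiset.erase_le k A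
      have hCk : C = ({k} + {r}) + A' := by
        rw [hCXA, hXr, hAk, ← Multiset.singleton_add]
        abel
      -- the hook case: all other columns are singletons, `λ` itself is small
      have hook : k = 1 → SmPos (gipEll L) lam := by
        intro hk1'
        refine small lam ?_ hE
        rw [hcardlam, Multiset.sup_le]
        intro c hc
        rw [hCXA, Multiset.mem_add] at hc
        rcases hc with hc | hc
        · exact (hXge c hc).2.trans (by norm_num)
        · exact (hAle c hc).trans (by omega)
      by_cases hr_two : r = 2
      · -- the exceptional column has length `2`
        subst hr_two
        rcases Nat.lt_or_ge k 2 with hk_lt | hk_ge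
        · exact hook (by omega)
        by_cases hA'0 : A' = 0
        · -- `λ = (2,2,1^{k-2})` is excluded
          exfalso
          apply h22 (k - 2)
          have hCk2 : C = {k - 2 + 2, 2} := by
            rw [hCk, hA'0, add_zero, Multiset.insert_eq_cons, ← Multiset.singleton_add,
              Nat.sub_add_cancel hk_ge]
          have hparts : lam.parts = (twoTwoCol (k - 2)).parts :=
            parts_eq_of_getD_sortedParts_eq fun i => by rw [hlamC, hCk2, getD_sortedParts_twoTwoCol]
          rw [hparts, twoTwoCol_parts]
        rcases Nat.lt_or_ge 14 k with hk14 | hk14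
        · -- `k > 14`: Prop. 19 on `(2,2,1^{k-2})`, whose rows are those of the columns `k, 2`
          have hrows : ∀ i, (twoTwoCol (k - 2)).sortedParts.getD i 0 = colCount ({k} + {2}) i := by
            intro i
            rw [getD_sortedParts_twoTwoCol, Nat.sub_add_cancel hk_ge, Multiset.insert_eq_cons,
              ← Multiset.singleton_add]
          have hbound : max 7 (Nat.sqrt (k - 2 + 1) + 1) ≤ gipEll L :=
            max_seven_sqrt_le_gipEll hk_ge hkL
          rcases h19 (k - 2) with hsm | ham
          · -- `sm((2,2,1^{k-2}), ℓ) > 0`: add the remaining columns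
            have hrs : IsRowSum lam (twoTwoCol (k - 2)) (ofColumns A') :=
              isRowSum_of_colCount (fun i => by rw [hlamC, hCk]) hrows
                (getD_sortedParts_ofColumns A')
            exact combine hrs (hsm.mono hbound) (good A' hA'le)
          · -- `am((2,2,1^{k-2}), ℓ) > 0`: a second long column `k₂` with `am(1^{k₂}, ℓ) > 0`
            set k₂ := A'.sup with hk₂
            have hk₂A' : k₂ ∈ A' := sup_mem_of_ne_zero hA'0
            obtain ⟨hk₂1, hk₂L, hk₂s⟩ := hAgood k₂ (Multiset.mem_of_le hA'le hk₂A')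
            set A'' := A'.erase k₂ with hA''
            have hA'k : A' = k₂ ::ₘ A'' := (Multiset.cons_erase hk₂A').symm
            have hA''le : A'' ≤ A := (Multiset.erase_le k₂ A').trans hA'le
            rcases Nat.lt_or_ge 14 k₂ with hk₂14 | hk₂14
            · have hk₂a : k₂ ∉ gipXa := by
                simp only [gipXa, Finset.mem_insert, Finset.mem_singleton]
                omega
              -- `δ` = columns `k, 2, k₂`
              have hδ : IsRowSum (ofColumns (({k} + {2}) + {k₂})) (twoTwoCol (k - 2))
                  (Nat.Partition.column k₂) :=
                isRowSum_of_colCount (getD_sortedParts_ofColumns _) hrows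
                  (getD_sortedParts_column k₂)
              have hδpos : SmPos (gipEll L) (ofColumns (({k} + {2}) + {k₂})) :=
                (h15 (gipEll L) (gipEll_pos L) _ _ _ hδ).2.1 (ham.mono hbound)
                  (amPos_column h17 hk₂1 hk₂L hk₂a)
              have hCk' : C = (({k} + {2}) + {k₂}) + A'' := by
                rw [hCk, hA'k, ← Multiset.singleton_add]
                abel
              have hrs : IsRowSum lam (ofColumns (({k} + {2}) + {k₂})) (ofColumns A'') :=
                isRowSum_of_colCount (fun i => by rw [hlamC, hCk']) (getD_sortedParts_ofColumns _)
                  (getD_sortedParts_ofColumns A'')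
              exact combine hrs hδpos (good A'' hA''le)
            · -- `k₂ ≤ 14`: Prop. 18 on the columns `k₂, 2`
              have hγsmall : SmPos (gipEll L) (ofColumns ({k₂} + {2})) := by
                refine small _ ?_ ?_
                · rw [card_parts_ofColumns, Multiset.sup_add, Multiset.sup_singleton,
                    Multiset.sup_singleton]
                  exact sup_le hk₂14 (by norm_num)
                · rcases Nat.lt_or_ge k₂ 2 with hk₂lt | hk₂ge
                  · -- the shape `(2,1)`: two parts, largest part `2`
                    intro hmem
                    have hk₂one : k₂ = 1 := by omega
                    have hcard : (ofColumns ({k₂} + {2})).parts.card = 2 := by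
                      rw [card_parts_ofColumns, Multiset.sup_add, Multiset.sup_singleton,
                        Multiset.sup_singleton, hk₂one]
                      decide
                    have hsup : (ofColumns ({k₂} + {2})).parts.sup = 2 := by
                      rw [sup_parts_ofColumns]
                      · simp
                      · intro c hc
                        simp only [Multiset.mem_add, Multiset.mem_singleton] at hc
                        omega
                    have := sup_eq_one_of_mem_gipExceptionalShapes_of_card_eq_two hmem hcard
                    omega
                  · exact parts_ofColumns_not_mem (fun c hc => by
                      simp only [Multiset.mem_add, Multiset.mem_singleton] at hc; omega) (by simp)
              have hCk' : C = ({k₂} + {2}) + ({k} + A'') := by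
                rw [hCk, hA'k, ← Multiset.singleton_add]
                abel
              have hrs : IsRowSum lam (ofColumns ({k₂} + {2})) (ofColumns ({k} + A'')) :=
                isRowSum_of_colCount (fun i => by rw [hlamC, hCk']) (getD_sortedParts_ofColumns _)
                  (getD_sortedParts_ofColumns _)
              refine combine hrs hγsmall (good _ ?_)
              rw [Multiset.singleton_add, hAk]
              exact Multiset.cons_le_cons k (Multiset.erase_le k₂ A')
        · -- `2 ≤ k ≤ 14`: Prop. 18 on the columns `k, 2` (a shape with two columns `≥ 2`)
          have hγsmall : SmPos (gipEll L) (ofColumns ({k} + {2})) := by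
            refine small _ ?_ (parts_ofColumns_not_mem (fun c hc => by
              simp only [Multiset.mem_add, Multiset.mem_singleton] at hc; omega) (by simp))
            rw [card_parts_ofColumns, Multiset.sup_add, Multiset.sup_singleton,
              Multiset.sup_singleton]
            exact sup_le hk14 (by norm_num)
          have hrs : IsRowSum lam (ofColumns ({k} + {2})) (ofColumns A') :=
            isRowSum_of_colCount (fun i => by rw [hlamC, hCk]) (getD_sortedParts_ofColumns _)
              (getD_sortedParts_ofColumns A')
          exact combine hrs hγsmall (good A' hA'le)
      · -- the exceptional column has length `r ≠ 2`, so `r ∉ X_a`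
        have hra : r ∉ gipXa := by
          simp only [gipXs, Finset.mem_insert, Finset.mem_singleton] at hr
          simp only [gipXa, Finset.mem_insert, Finset.mem_singleton]
          omega
        by_cases hka : k ∈ gipXa
        · rcases Nat.lt_or_ge k 2 with hk_lt | hk_ge
          · exact hook (by omega)
          · -- `k ∈ X_a`, `k ≥ 2`: Prop. 18 on the columns `k, r` (both `≥ 2`, `k ≤ 14`)
            have hk14 : k ≤ 14 := by
              simp only [gipXa, Finset.mem_insert, Finset.mem_singleton] at hka
              omega
            have hγsmall : SmPos (gipEll L) (ofColumns ({k} + {r})) := by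
              refine small _ ?_ (parts_ofColumns_not_mem (fun c hc => by
                simp only [Multiset.mem_add, Multiset.mem_singleton] at hc; omega) (by simp))
              rw [card_parts_ofColumns, Multiset.sup_add, Multiset.sup_singleton,
                Multiset.sup_singleton]
              exact sup_le hk14 (by omega)
            have hrs : IsRowSum lam (ofColumns ({k} + {r})) (ofColumns A') :=
              isRowSum_of_colCount (fun i => by rw [hlamC, hCk]) (getD_sortedParts_ofColumns _)
                (getD_sortedParts_ofColumns A')
            exact combine hrs hγsmall (good A' hA'le)
        · -- `k ∉ X_a`: `am(1^k, ℓ), am(1^r, ℓ) > 0`, so `sm(1^k + 1^r, ℓ) > 0` by Prop. 15(2)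
          have hγ : IsRowSum (ofColumns ({k} + {r})) (Nat.Partition.column k)
              (Nat.Partition.column r) :=
            isRowSum_of_colCount (getD_sortedParts_ofColumns _) (getD_sortedParts_column k)
              (getD_sortedParts_column r)
          have hrC : r ∈ C := by
            rw [hCXA, hXr]
            exact Multiset.mem_add.mpr (Or.inl (Multiset.mem_singleton_self r))
          have hγpos : SmPos (gipEll L) (ofColumns ({k} + {r})) :=
            (h15 (gipEll L) (gipEll_pos L) _ _ _ hγ).2.1 (amPos_column h17 hk1 hkL hka)
              (amPos_column h17 (by omega) (hCL r hrC) hra)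
          have hrs : IsRowSum lam (ofColumns ({k} + {r})) (ofColumns A') :=
            isRowSum_of_colCount (fun i => by rw [hlamC, hCk]) (getD_sortedParts_ofColumns _)
              (getD_sortedParts_ofColumns A')
          exact combine hrs hγpos (good A' hA'le)
  · -- `x ≥ 2`: Prop. 18 on the exceptional columns, Prop. 17 + 15(1) on the others
    have hβsmall : SmPos (gipEll L) (ofColumns X) := by
      refine small _ ?_ (parts_ofColumns_not_mem (fun c hc => (hXge c hc).1) hx)
      rw [card_parts_ofColumns, Multiset.sup_le]
      exact fun c hc => (hXge c hc).2.trans (by norm_num)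
    exact combine (isRowSum_ofColumns lam hCXA) hβsmall (good A le_rfl)

-- `linter.deprecated` off for the next declaration only: it names the refuted, deprecated records
-- `GIP2017_prop18`, `GIP2017_prop19` (and the deprecated `GIP2017_prop20_of_parts`) and is
-- deprecated itself. REMOVE-WHEN the two records are deleted from `GCTMatrixPoweringColumns.lean`.
set_option linter.deprecated false in
/-- **GIP Thm. 10 from the printed ingredients of §3**: Props. 15, 17, 18, 19 (through Prop. 20,
Prop. 14, Lemma 12 and Prop. 13). **Deprecated (2026-08-15)**: vacuous, its hypotheses
`GIP2017_prop18`, `GIP2017_prop19` being refuted as printed; use `GIP2017_thm10_of_prop18`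
(`GCTMatrixPoweringProp17.lean`) or the unconditional `GCTMatrixPowering_holds`
(`GCTMatrixPoweringProp20Holds.lean`). [cite: GesmundoIkenmeyerPanova2017, Thm. 10 (proof) and §3] -/
@[deprecated "vacuous: the hypotheses GIP2017_prop18 and GIP2017_prop19 are refuted as printed; use Literature.Barriers.ValiantsHypothesis.GIP2017_thm10_of_prop18 (GCTMatrixPoweringProp17.lean) or GCTMatrixPowering_holds (GCTMatrixPoweringProp20Holds.lean)" (since := "2026-08-15")]
theorem GIP2017_thm10_of_parts (h15 : GIP2017_prop15) (h17 : GIP2017_prop17)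
    (h18 : GIP2017_prop18) (h19 : GIP2017_prop19) : GIP2017_thm10 :=
  GIP2017_thm10_of_prop20 (GIP2017_prop20_of_parts h15 h17 h18 h19)

-- `linter.deprecated` off for the next declaration only (same reason); REMOVE-WHEN as above.
set_option linter.deprecated false in
/-- The barrier fact `GCTMatrixPowering` from Props. 15, 17, 18, 19. **Deprecated (2026-08-15)**:
vacuous, its hypotheses `GIP2017_prop18`, `GIP2017_prop19` being refuted as printed; use
`gctMatrixPowering_of_prop18` (`GCTMatrixPoweringProp17.lean`) or the unconditional
`GCTMatrixPowering_holds` (`GCTMatrixPoweringProp20Holds.lean`). [cite: GesmundoIkenmeyerPanova2017, Thm. 10] -/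
@[deprecated "vacuous: the hypotheses GIP2017_prop18 and GIP2017_prop19 are refuted as printed; use Literature.Barriers.ValiantsHypothesis.gctMatrixPowering_of_prop18 (GCTMatrixPoweringProp17.lean) or GCTMatrixPowering_holds (GCTMatrixPoweringProp20Holds.lean)" (since := "2026-08-15")]
theorem gctMatrixPowering_of_parts (h15 : GIP2017_prop15) (h17 : GIP2017_prop17)
    (h18 : GIP2017_prop18) (h19 : GIP2017_prop19) : GCTMatrixPowering :=
  GIP2017_thm10_of_parts h15 h17 h18 h19

end Literature.Barriers.ValiantsHypothesis

end
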